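import Mathlib
import HarnessLib

/-!
# `DefectWeb`: the priced cuts of `TetrahedronCarving` are sharp relative to the record

Support kernel for `stmt-MatrixMultiplication-26697` (`TetraExcessZero`) of route `TetrahedronCarving`
(lineage `decomp-mm-lens-6`, generation 21), companion of `EdgePencilDefectCone` / `EdgePencilDefectCuts`.
Pure bookkeeping over `ℝ` (no tensors): a `DefectWeb` is a model of EVERY inequality the tree records
between `ω` (`om`), `ω(1,1/2,1)` (`mid`; `ω(2,1,2) = 2·mid`), `ω(K₄)` (`tet`) and `α` (`al`) —
`2 ≤ ω ≤ ω(1,1/2,1) + 1/2` (`RectangularExponentAlpha.omegaRect_one_mid_one_le_add`), `α ≤ 1`,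
`α = 1 ⟺ ω = 2` (`dualExponentAlpha_eq_one_iff`), `ω(1,1/2,1) = 2 ⟺ α ≥ 1/2`
(`omegaRect_eq_two_iff_le_dualExponentAlpha`), the chord `ω(1,1/2,1) ≤ 2 + (1/2 − a)/(1 − a)·(ω − 2)` for
EVERY `0 ≤ a ≤ min(α,1/2)` (`EdgePencil.omegaRect_half_le_chord`), the grouping floor `2ω(1,1/2,1) ≤ ω(K₄)`
and the cover `ω(K₄) ≤ 2ω` (`TetrahedronTensor`), the EPR padding `ω(K₄) ≤ ω(2,1,2) + 1`
(`EdgePencilSixthLadder.omegaTetra_le_omegaSix_add` at `δ = 0`), the Lotti–Romani shadow `ω(K₄) ≤ 4 → ω ≤ 12/5`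
(`TetrahedronTensorConsequences`), and the printed record `α ≥ 0.3213` — in which the pencils read
`A k : tet − 4 ≤ k·(2·mid − 4)` and `B c : 4 + c·(om − 2) ≤ tet`.

* The pricing theorem holds in every web (`om_eq_two_of_cut`: `0 ≤ k`, `a ≤ min(al,1/2)`, `c > k·κ(a)` ⟹
  `A k → B c → om = 2`), and NOTHING CHEAPER does: there are webs with `om ≠ 2` (all below the printed
  `ω < 2.3714`, `ω(K₄) < 4.633908`) satisfying `B 1 ∧ ¬ B 2` (`plusTwoWorld`: `TetraPlusTwo` is strictly weaker
  than `TetraNoSaving`), `A 2 ∧ ¬ A 1` (`doubleDefectWorld`: `A_2` strictly weaker than `TetraExcessZero`),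
  `A 2 ∧ B 1` at `al = 0.3214 < 1/3` (`thirdWorld`: both notches at once are not a cut on the record),
  `B 2 ∧ A 3.81` (`noSavingWorld`: the residual-side threshold `k < 2/κ(α) ≈ 3.80` is sharp),
  `A 1 ∧ B 0.525` (`excessZeroWorld'`: the attacked-side threshold `c > κ(α) ≈ 0.5264` is sharp), and
  `tet = 4 ∧ ∀ c > 0, ¬ B c` (`flatWorld`: the `B`-core `TetraFlat → ω = 2` is not bookkeeping).

References: Christandl–Vrana–Zuiddam, arXiv:1609.07476, §1.2–1.3 (graph tensors, `ω(K₄)`, Question 1.3.2);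
Lotti–Romani 1983 (`ω(1,k,1)` convex, flat on `[0,α]`); Coppersmith 1982 (`α > 0.17227`);
Vassilevska Williams–Xu–Xu–Zhou 2024 (`α > 0.321334`); Brand et al. 2026, Thm. 48 (`ω(K₄) < 4.633908`).
[ChristandlVranaZuiddam2016] [LottiRomani1983] [Coppersmith1982] [VassilevskaWilliamsXuXuZhou2024] [BrandEtAl2026]
-/

noncomputable section

set_option linter.dupNamespace false

namespace Summit.MatrixMultiplication.MatrixMultiplication.Theorems.EdgePencil


/-- A model of EVERY inequality the tree records between `ω` (`om`), `ω(1,1/2,1)` (`mid`), `ω(K₄)` (`tet`)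
and `α` (`al`): `2 ≤ ω ≤ ω(1,1/2,1) + 1/2`, `0 ≤ α ≤ 1`, `α = 1 ⟺ ω = 2`, `ω(1,1/2,1) = 2 ⟺ α ≥ 1/2`,
the chord `ω(1,1/2,1) ≤ 2 + (1/2 − a)/(1 − a)·(ω − 2)` for EVERY `0 ≤ a ≤ min(α,1/2)`, the grouping floor
`2ω(1,1/2,1) = ω(2,1,2) ≤ ω(K₄)`, the cover `ω(K₄) ≤ 2ω`, the EPR padding `ω(K₄) ≤ ω(2,1,2) + 1`, the
Lotti–Romani shadow `ω(K₄) ≤ 4 → ω ≤ 12/5`, and the printed record `α ≥ 0.3213`. -/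
structure DefectWeb where
  /-- stands for `ω` -/
  om : ℝ
  /-- stands for `ω(1,1/2,1)` (`ω(2,1,2) = 2·mid`) -/
  mid : ℝ
  /-- stands for `ω(K₄)` -/
  tet : ℝ
  /-- stands for `α` -/
  al : ℝ
  two_le_om : 2 ≤ om
  two_le_mid : 2 ≤ mid
  om_le_mid_add_half : om ≤ mid + 1 / 2
  al_record : (0.3213 : ℝ) ≤ al
  al_le_one : al ≤ 1
  al_eq_one_iff : al = 1 ↔ om = 2
  mid_eq_two_iff : mid = 2 ↔ 1 / 2 ≤ al
  chord : ∀ a : ℝ, 0 ≤ a → a ≤ 1 / 2 → a ≤ al → mid ≤ 2 + (1 / 2 - a) / (1 - a) * (om - 2)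
  two_mid_le_tet : 2 * mid ≤ tet
  tet_le_two_om : tet ≤ 2 * om
  tet_le_two_mid_add_one : tet ≤ 2 * mid + 1
  shadow : tet ≤ 4 → om ≤ 12 / 5

namespace DefectWeb

variable (W : DefectWeb)

/-- `A_k` in a web. -/
def A (k : ℝ) : Prop := W.tet - 4 ≤ k * (2 * W.mid - 4)

/-- `B_c` in a web. -/
def B (c : ℝ) : Prop := 4 + c * (W.om - 2) ≤ W.tet

/-- The pricing theorem holds in every web: `0 ≤ k`, `0 ≤ a ≤ min(al,1/2)`, `c > k·κ(a)` ⟹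
`A_k → B_c → om = 2`. -/
theorem om_eq_two_of_cut {k c a : ℝ} (ha0 : 0 ≤ a) (ha : a ≤ 1 / 2) (hal : a ≤ W.al) (hk : 0 ≤ k)
    (hkc : k * ((1 - 2 * a) / (1 - a)) < c) (hA : W.A k) (hB : W.B c) : W.om = 2 := by
  have hd : 0 ≤ W.om - 2 := by linarith [W.two_le_om]
  have hch := W.chord a ha0 ha hal
  have hid : (1 - 2 * a) / (1 - a) = 2 * ((1 / 2 - a) / (1 - a)) := by
    rw [mul_div_assoc']
    congr 1
    ring
  have hρ : 2 * W.mid - 4 ≤ (1 - 2 * a) / (1 - a) * (W.om - 2) := by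
    rw [hid]
    linarith
  unfold A at hA
  unfold B at hB
  have h2 : k * (2 * W.mid - 4) ≤ k * ((1 - 2 * a) / (1 - a) * (W.om - 2)) :=
    mul_le_mul_of_nonneg_left hρ hk
  rcases hd.eq_or_lt with h0 | hpos
  · linarith
  · have h3 : k * ((1 - 2 * a) / (1 - a)) * (W.om - 2) < c * (W.om - 2) :=
      mul_lt_mul_of_pos_right hkc hpos
    have h4 : k * ((1 - 2 * a) / (1 - a) * (W.om - 2)) =
        k * ((1 - 2 * a) / (1 - a)) * (W.om - 2) := by ring
    linarith

/-- The chord slope at the record: for `a ≤ 0.3214`, `(1/2 − a)/(1 − a) ≥ 0.2631`. -/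
private theorem slope_ge {a : ℝ} (ha : a ≤ 0.3214) : (0.2631 : ℝ) ≤ (1 / 2 - a) / (1 - a) := by
  rw [le_div_iff₀ (by linarith)]
  linarith

/-- `ω = 2.37`, `ω(1,1/2,1) = 2.04`, `ω(K₄) = 4.5`, `α = 0.3214`: `TetraPlusTwo` holds, `TetraNoSaving` fails. -/
def plusTwoWorld : DefectWeb where
  om := 2.37
  mid := 2.04
  tet := 4.5
  al := 0.3214
  two_le_om := by norm_num
  two_le_mid := by norm_num
  om_le_mid_add_half := by norm_num
  al_record := by norm_num
  al_le_one := by norm_num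
  al_eq_one_iff := by norm_num
  mid_eq_two_iff := by norm_num
  chord := fun a _ _ hal => by
    have hs := slope_ge hal
    nlinarith
  two_mid_le_tet := by norm_num
  tet_le_two_om := by norm_num
  tet_le_two_mid_add_one := by norm_num
  shadow := by norm_num

/-- `ω = 2.37`, `ω(1,1/2,1) = 2.04`, `ω(K₄) = 4.15`, `α = 0.3214`: `A_2` holds (`0.15 ≤ 2·0.08`),
`TetraExcessZero` and `TetraPlusTwo` fail. -/
def doubleDefectWorld : DefectWeb where
  om := 2.37
  mid := 2.04
  tet := 4.15
  al := 0.3214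
  two_le_om := by norm_num
  two_le_mid := by norm_num
  om_le_mid_add_half := by norm_num
  al_record := by norm_num
  al_le_one := by norm_num
  al_eq_one_iff := by norm_num
  mid_eq_two_iff := by norm_num
  chord := fun a _ _ hal => by
    have hs := slope_ge hal
    nlinarith
  two_mid_le_tet := by norm_num
  tet_le_two_om := by norm_num
  tet_le_two_mid_add_one := by norm_num
  shadow := by norm_num

/-- `ω = 2.15`, `ω(1,1/2,1) = 2.039`, `ω(K₄) = 4.153`, `α = 0.3214 < 1/3`: `A_2 ∧ TetraPlusTwo` holds with
`ω ≠ 2` — the two one-notch weakenings do not combine on the record (`α > 1/3` would do it). -/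
def thirdWorld : DefectWeb where
  om := 2.15
  mid := 2.039
  tet := 4.153
  al := 0.3214
  two_le_om := by norm_num
  two_le_mid := by norm_num
  om_le_mid_add_half := by norm_num
  al_record := by norm_num
  al_le_one := by norm_num
  al_eq_one_iff := by norm_num
  mid_eq_two_iff := by norm_num
  chord := fun a _ _ hal => by
    have hs := slope_ge hal
    nlinarith
  two_mid_le_tet := by norm_num
  tet_le_two_om := by norm_num
  tet_le_two_mid_add_one := by norm_num
  shadow := by norm_num

/-- `ω = 2.15`, `ω(1,1/2,1) = 2.0394`, `ω(K₄) = 4.3 = 2ω`, `α = 0.3214`: `TetraNoSaving ∧ A_{3.81}` holds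
with `ω ≠ 2` — the threshold `k < 2/κ(α) ≈ 3.80` of `matrixMultiplication_iff_defectRatioLE_and_tetraNoSaving`
is sharp relative to the record. -/
def noSavingWorld : DefectWeb where
  om := 2.15
  mid := 2.0394
  tet := 4.3
  al := 0.3214
  two_le_om := by norm_num
  two_le_mid := by norm_num
  om_le_mid_add_half := by norm_num
  al_record := by norm_num
  al_le_one := by norm_num
  al_eq_one_iff := by norm_num
  mid_eq_two_iff := by norm_num
  chord := fun a _ _ hal => by
    have hs := slope_ge hal
    nlinarith
  two_mid_le_tet := by norm_num
  tet_le_two_om := by norm_num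
  tet_le_two_mid_add_one := by norm_num
  shadow := by norm_num

/-- `ω = 2.15`, `ω(1,1/2,1) = 2.0394`, `ω(K₄) = ω(2,1,2) = 4.0788`, `α = 0.3214`: `TetraExcessZero ∧ B_{0.525}`
holds with `ω ≠ 2` — the threshold `c > κ(α) ≈ 0.5264` of
`matrixMultiplication_iff_tetraExcessZero_and_transferGE` is sharp relative to the record. -/
def excessZeroWorld' : DefectWeb where
  om := 2.15
  mid := 2.0394
  tet := 4.0788
  al := 0.3214
  two_le_om := by norm_num
  two_le_mid := by norm_num
  om_le_mid_add_half := by norm_num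
  al_record := by norm_num
  al_le_one := by norm_num
  al_eq_one_iff := by norm_num
  mid_eq_two_iff := by norm_num
  chord := fun a _ _ hal => by
    have hs := slope_ge hal
    nlinarith
  two_mid_le_tet := by norm_num
  tet_le_two_om := by norm_num
  tet_le_two_mid_add_one := by norm_num
  shadow := by norm_num

/-- `ω = 2.3`, `ω(1,1/2,1) = 2`, `ω(K₄) = 4`, `α = 0.6`: `TetraFlat` (so every `A_k`) holds with `ω ≠ 2`;
every `B_c`, `c > 0`, fails — the `B`-core `TetraFlat → ω = 2` is not bookkeeping. -/
def flatWorld : DefectWeb where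
  om := 2.3
  mid := 2
  tet := 4
  al := 0.6
  two_le_om := by norm_num
  two_le_mid := by norm_num
  om_le_mid_add_half := by norm_num
  al_record := by norm_num
  al_le_one := by norm_num
  al_eq_one_iff := by norm_num
  mid_eq_two_iff := by norm_num
  chord := fun a ha0 ha _ => by
    have hs : 0 ≤ (1 / 2 - a) / (1 - a) := div_nonneg (by linarith) (by linarith)
    nlinarith
  two_mid_le_tet := by norm_num
  tet_le_two_om := by norm_num
  tet_le_two_mid_add_one := by norm_num
  shadow := by norm_num

/-- **`TetraPlusTwo` is strictly weaker than `TetraNoSaving` and undecided, relative to the record**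
(and it is not implied by `A_2`). -/
theorem plusTwo_undecided :
    (plusTwoWorld.B 1 ∧ ¬ plusTwoWorld.B 2 ∧ plusTwoWorld.om ≠ 2 ∧ plusTwoWorld.om ≤ 2.3714 ∧
        plusTwoWorld.tet < 4.633908) ∧ ¬ doubleDefectWorld.B 1 := by
  refine ⟨⟨?_, ?_, ?_, ?_, ?_⟩, ?_⟩ <;> norm_num [B, plusTwoWorld, doubleDefectWorld]

/-- **`A_2` is strictly weaker than `TetraExcessZero` and undecided, relative to the record**
(and it is not implied by `TetraPlusTwo`). -/
theorem doubleDefect_undecided :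
    (doubleDefectWorld.A 2 ∧ ¬ doubleDefectWorld.A 1 ∧ doubleDefectWorld.om ≠ 2 ∧
        doubleDefectWorld.om ≤ 2.3714 ∧ doubleDefectWorld.tet < 4.633908) ∧ ¬ plusTwoWorld.A 2 := by
  refine ⟨⟨?_, ?_, ?_, ?_, ?_⟩, ?_⟩ <;> norm_num [A, plusTwoWorld, doubleDefectWorld]

/-- **Both notches at once are NOT a cut on the record**: `A_2 ∧ B_1 ∧ ω ≠ 2` at `α = 0.3214 < 1/3`. -/
theorem doubleDefect_and_plusTwo_not_a_cut :
    thirdWorld.A 2 ∧ thirdWorld.B 1 ∧ thirdWorld.om ≠ 2 ∧ thirdWorld.al < 1 / 3 := by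
  refine ⟨?_, ?_, ?_, ?_⟩ <;> norm_num [A, B, thirdWorld]

/-- **The residual-side threshold is sharp**: `TetraNoSaving ∧ A_{3.81} ∧ ω ≠ 2` is consistent with the record
(while `A_k ∧ TetraNoSaving ⟹ ω = 2` for `k ≤ 3.79`). -/
theorem noSaving_threshold_sharp :
    noSavingWorld.B 2 ∧ noSavingWorld.A 3.81 ∧ noSavingWorld.om ≠ 2 := by
  refine ⟨?_, ?_, ?_⟩ <;> norm_num [A, B, noSavingWorld]

/-- **The attacked-side threshold is sharp**: `TetraExcessZero ∧ B_{0.525} ∧ ω ≠ 2` is consistent with the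
record (while `TetraExcessZero ∧ B_c ⟹ ω = 2` for `c ≥ 0.5267`). -/
theorem excessZero_threshold_sharp :
    excessZeroWorld'.A 1 ∧ excessZeroWorld'.B 0.525 ∧ excessZeroWorld'.om ≠ 2 := by
  refine ⟨?_, ?_, ?_⟩ <;> norm_num [A, B, excessZeroWorld']

/-- **The `B`-core is not bookkeeping**: `TetraFlat` (hence every `A_k`, `k ≥ 0`) holds in `flatWorld` with
`ω ≠ 2`, and every `B_c` with `c > 0` fails there. -/
theorem flat_not_summit :
    flatWorld.tet ≤ 4 ∧ flatWorld.om ≠ 2 ∧ (∀ k : ℝ, 0 ≤ k → flatWorld.A k) ∧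
      ∀ c : ℝ, 0 < c → ¬ flatWorld.B c := by
  refine ⟨by norm_num [flatWorld], by norm_num [flatWorld], fun k hk => ?_, fun c hc => ?_⟩
  · show flatWorld.tet - 4 ≤ k * (2 * flatWorld.mid - 4)
    norm_num [flatWorld]
  · show ¬ (4 + c * (flatWorld.om - 2) ≤ flatWorld.tet)
    norm_num [flatWorld]
    linarith

end DefectWeb

end Summit.MatrixMultiplication.MatrixMultiplication.Theorems.EdgePencil

end
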